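import Literature.Algebra.Homology.CharpolyReverseEulerPoincare
import Literature.Algebra.Homology.LefschetzNumber
import HarnessLib

/-!
# Endomorphisms of an acyclic complex: the super-trace vanishes, the alternating products of characteristic polynomials are `1`

Layer `Literature/Algebra/Homology` (pure linear algebra over Mathlib; proved theorems only, 0 definitions, 0 named facts, no instances,
no notation). For an endomorphism `φ` of an ACYCLIC (`∀ i, C.ExactAt i`) homological complex of finite-dimensional vector spaces with finitely
many non-zero terms (any shape `c` with `EulerCharSigns`) — in particular an endomorphism of a finite exact sequence — the homology side of rows
`LefschetzNumber` / `CharpolyEulerPoincare` / `CharpolyReverseEulerPoincare` is trivial, whence (Lang XX §3 Thm. 3.1 with `H(E) = 0`):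

* `finsum_χ_smul_trace_f_eq_zero_of_exactAt` — `Σᶠ χ(i) • tr(φᵢ) = 0`, and `CochainComplex.sum_negOnePow_smul_trace_eq_zero_of_exactAt`;
* `finprod_charpoly_zpow_χ_eq_one_of_exactAt` — `∏ᶠ ↑χ(φᵢ)^{χ(i)} = 1` in `RatFunc K`, and `CochainComplex.prod_charpoly_zpow_negOnePow_eq_one_of_exactAt`;
* `finprod_reverse_charpoly_zpow_χ_eq_one_of_exactAt` — `∏ᶠ ↑(det(1 − tφᵢ))^{χ(i)} = 1`, and its `ℤ`-`Icc` form.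

Corollaries BY NAME of rows `LefschetzNumber` (`lefschetzNumber_eq_zero_of_exactAt`), `CharpolyEulerPoincare`, `CharpolyReverseEulerPoincare`; nothing
is restated. Library only (cell `pub-hodge-ring2`, count-neutral); proves nothing about any crux, route or conjecture.

## References

* S. Lang, *Algebra* (2002), Ch. XX §3, Thm. 3.1. [Lang2002]
* A. Hatcher, *Algebraic Topology* (2002), §2.C. [HatcherAT2002]
-/

open CategoryTheory CategoryTheory.Limits Polynomial

universe v u w

namespace Literature.Algebra.Homology.HopfTrace

variable {K : Type u} [Field K] {ι : Type w} {c : ComplexShape ι} (C : HomologicalComplex (ModuleCat.{v} K) c) (φ : C ⟶ C)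

/-- In an acyclic complex every homology space is trivial. [cite: Lang2002, Ch. XX §3] -/
theorem subsingleton_homology_of_exactAt (hex : ∀ i, C.ExactAt i) (i : ι) : Subsingleton (C.homology i) :=
  ModuleCat.subsingleton_of_isZero ((C.exactAt_iff_isZero_homology i).1 (hex i))

/-- **An endomorphism of an acyclic complex has super-trace `0`**: `Σᶠ χ(i) • tr(φᵢ) = 0`. [cite: Lang2002, Ch. XX §3, Thm. 3.1] -/
theorem finsum_χ_smul_trace_f_eq_zero_of_exactAt [c.EulerCharSigns] [∀ i, Module.Finite K (C.X i)]
    (hC : (GradedObject.finrankSupport C.X).Finite) (hex : ∀ i, C.ExactAt i) :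
    ∑ᶠ i, (c.χ i : ℤ) • LinearMap.trace K (C.X i) (φ.f i).hom = 0 := by
  rw [← Lefschetz.lefschetzNumber_eq_finsum_χ_smul_trace_f φ hC, Lefschetz.lefschetzNumber_eq_zero_of_exactAt hex φ]

/-- **`∏ᶠ χ(φᵢ)^{χ(i)} = 1`** in `RatFunc K` for an endomorphism of an acyclic complex. [cite: Lang2002, Ch. XX §3, Thm. 3.1] -/
theorem finprod_charpoly_zpow_χ_eq_one_of_exactAt [c.EulerCharSigns] [∀ i, Module.Finite K (C.X i)]
    (hC : (GradedObject.finrankSupport C.X).Finite) (hex : ∀ i, C.ExactAt i) :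
    ∏ᶠ i, algebraMap K[X] (RatFunc K) (φ.f i).hom.charpoly ^ ((c.χ i : ℤ)) = 1 := by
  haveI : ∀ i, Module.Finite K (C.homology i) := fun i => moduleFinite_homology C i
  rw [finprod_charpoly_zpow_χ_eq C φ hC]
  exact finprod_eq_one_of_forall_eq_one fun i => by
    haveI := subsingleton_homology_of_exactAt C hex i
    rw [charpoly_eq_one_of_subsingleton, map_one, one_zpow]

/-- **`∏ᶠ det(1 − tφᵢ)^{χ(i)} = 1`** (reversed characteristic polynomials) for an endomorphism of an acyclic complex.
[cite: Lang2002, Ch. XX §3, Thm. 3.1] -/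
theorem finprod_reverse_charpoly_zpow_χ_eq_one_of_exactAt [c.EulerCharSigns] [∀ i, Module.Finite K (C.X i)]
    (hC : (GradedObject.finrankSupport C.X).Finite) (hex : ∀ i, C.ExactAt i) :
    ∏ᶠ i, algebraMap K[X] (RatFunc K) (φ.f i).hom.charpoly.reverse ^ ((c.χ i : ℤ)) = 1 := by
  haveI : ∀ i, Module.Finite K (C.homology i) := fun i => moduleFinite_homology C i
  rw [finprod_reverse_charpoly_zpow_χ_eq C φ hC]
  exact finprod_eq_one_of_forall_eq_one fun i => by
    haveI := subsingleton_homology_of_exactAt C hex i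
    rw [charpoly_eq_one_of_subsingleton, reverse_one_eq, map_one, one_zpow]

end Literature.Algebra.Homology.HopfTrace

namespace Literature.Algebra.Homology.CochainComplex

open Literature.Algebra.Homology.HopfTrace

variable {K : Type u} [Field K] (C : CochainComplex (ModuleCat.{v} K) ℤ) (φ : C ⟶ C) [∀ n, Module.Finite K (C.X n)] (a b : ℤ)

/-- **`Σ_{n=a}^{b} (−1)ⁿ tr(φⁿ) = 0`** for an endomorphism of an exact bounded cochain complex (`Cⁿ = 0` outside `[a, b]`).
[cite: Lang2002, Ch. XX §3, Thm. 3.1] [cite: HatcherAT2002, Thm. 2C.3] -/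
theorem sum_negOnePow_smul_trace_eq_zero_of_exactAt (hC : ∀ n, n ∉ Finset.Icc a b → IsZero (C.X n)) (hex : ∀ n, C.ExactAt n) :
    ∑ n ∈ Finset.Icc a b, (n.negOnePow : ℤ) • LinearMap.trace K (C.X n) (φ.f n).hom = 0 := by
  rw [← lefschetzNumber_eq_sum_Icc C φ a b hC, Lefschetz.lefschetzNumber_eq_zero_of_exactAt hex φ]

/-- **`∏_{n=a}^{b} χ(φⁿ)^{(−1)ⁿ} = 1`** in `RatFunc K` for an endomorphism of an exact bounded cochain complex. [cite: Lang2002, Ch. XX §3, Thm. 3.1] -/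
theorem prod_charpoly_zpow_negOnePow_eq_one_of_exactAt (hC : ∀ n, n ∉ Finset.Icc a b → IsZero (C.X n)) (hex : ∀ n, C.ExactAt n) :
    ∏ n ∈ Finset.Icc a b, algebraMap K[X] (RatFunc K) (φ.f n).hom.charpoly ^ ((n.negOnePow : ℤ)) = 1 := by
  haveI : ∀ n, Module.Finite K (C.homology n) := fun n => moduleFinite_homology C n
  rw [prod_charpoly_zpow_negOnePow_eq C φ a b hC]
  exact Finset.prod_eq_one fun n _ => by
    haveI := subsingleton_homology_of_exactAt C hex n
    rw [charpoly_eq_one_of_subsingleton, map_one, one_zpow]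

/-- **`∏_{n=a}^{b} det(1 − tφⁿ)^{(−1)ⁿ} = 1`** for an endomorphism of an exact bounded cochain complex. [cite: Lang2002, Ch. XX §3, Thm. 3.1] -/
theorem prod_reverse_charpoly_zpow_negOnePow_eq_one_of_exactAt (hC : ∀ n, n ∉ Finset.Icc a b → IsZero (C.X n))
    (hex : ∀ n, C.ExactAt n) :
    ∏ n ∈ Finset.Icc a b, algebraMap K[X] (RatFunc K) (φ.f n).hom.charpoly.reverse ^ ((n.negOnePow : ℤ)) = 1 := by
  haveI : ∀ n, Module.Finite K (C.homology n) := fun n => moduleFinite_homology C n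
  rw [prod_reverse_charpoly_zpow_negOnePow_eq C φ a b hC]
  exact Finset.prod_eq_one fun n _ => by
    haveI := subsingleton_homology_of_exactAt C hex n
    rw [charpoly_eq_one_of_subsingleton, reverse_one_eq, map_one, one_zpow]

end Literature.Algebra.Homology.CochainComplex
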